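import Summits.ResolutionOfSingularities.ResolutionOfSingularities.Theorems.PurelyInseparableDim4ChartAtlasSNCFarRepairWPairs
import HarnessLib

/-!
# Purely inseparable four-folds `z^p + F(x₁, …, x₄)`: THE FAR SIDE OF S3-N2 ON `W`, UNCONDITIONAL FORM — for a pair-list boundary with
# `|B_near| ≤ 1`, EITHER the escaping global centre is snc with the transformed boundary OR one extra blow-up along the far-resonance loci
# repairs it (cell `res-dim4-pi`, typ-2 g7; the heights are COMPUTED from the data — no height hypothesis remains)

[OURS · counted 0] (D-0157 DOOR 2; DR-157-C.) Setting of PA3c p714892 (typ-3's entry point): `π : W → 𝔸⁵` ANY blowing up along `V(z, x_S)`, chart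
`j ∈ S`, `b_j = 0`, re-centring `Θⱼ` of record (`z^p + F ↦ x_j^p (z^p + F₁)`), `F ≠ 0` clean `S`-permissible, `F₁` `S'`-permissible, `j ∉ S'`,
`S' ≠ ∅`, pair-list boundary `E = [(xᵢ + c)·𝒪 : (i, c) ∈ L]`, `|B_near| ≤ 1` (hB1/hB2). p714892 needed «pairwise distinct active far heights»
(hH1/hH2); p720641 (`…SNCFarRepairWPairs`) repairs a GIVEN list of resonant heights. PROVED here (no `sorry`, no new axiom):

* **`farSide_globalCentre_pairs`** — WITHOUT ANY HEIGHT HYPOTHESIS: there is a nodup list `hs` of non-zero heights (the COLLISION HEIGHTS: heights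
  `−d/bᵢ` of active far pairs `(i, d)` shared with another active pair or with an index-`j` far hyperplane `(j, c)`, `c = −h`) such that
  (a) if `hs = []` then `HasSNCWith M′.boundary Zc` (p714892), and (b) if `hs ≠ []` then the stage repair centre `C_W = 𝓘(closure φⱼ V(C(hs)))` is
  admissible for `M′` (p720422 `farRepairCentre_package_pairs`) and for EVERY blowing up `τ` of `W` along `C_W` the strict transform `St_τ(Zc)` is
  REGULAR, inside `supp(M′.transform τ C_W)`, and snc with `(M′.transform τ C_W).boundary` (p720641).

WORDS (S3-N2, far side, on W, final form): «escaping case, S′ ≠ ∅, |B_near| ≤ 1 ⟹ the escaping global centre is admissible now, or after exactly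
ONE extra blow-up along the disjoint union of its far-resonance loci (a closed regular centre inside Zc ∩ (x_j-chart), snc with the boundary)».
Nothing here is a statement about resolution of singularities in dimension ≥ 4 / characteristic `p` (NOT proved anywhere in this programme).
bears_on: LADDER-RESOLUTION:D157-DOOR2 (res-dim4-pi). Supports stmt-ResolutionOfSingularities-16155 (helper).
-/

-- every declaration of this summit lives under `Summit.ResolutionOfSingularities.ResolutionOfSingularities`
-- (summit = problem), which the duplicate-namespace linter flags; house convention (cf. the Target file).
set_option linter.dupNamespace false

noncomputable section

open MvPolynomial CategoryTheory AlgebraicGeometry Opposite TopologicalSpace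
open AlgebraicGeometry.Scheme.IdealSheafData (ofIdealTop vanishingIdeal)

namespace Summit.ResolutionOfSingularities.ResolutionOfSingularities.Theorems.PIDim4

open Literature.AlgebraicGeometry.Resolution
open Literature.AlgebraicGeometry.Resolution.Hauser2010
open Literature.AlgebraicGeometry.Resolution.AffinePointBlowup (P A γ coord Wtop ξ)
open Literature.Barriers.ResolutionOfSingularities

namespace ChartDictionary

variable {K : Type} [Field K] {p : ℕ} [hp : Fact p.Prime] [CharP K p]
  {S S' : Finset (Fin 4)} {j : Fin 4} {b : Fin 4 → K} {Θⱼ : A 4 K ≃ₐ[K] A 4 K} {h : MvPolynomial (Fin 4) K}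
  {F F₁ : MvPolynomial (Fin 4) K} {W : Scheme.{0}} {π : W ⟶ P 4 K}

/-- **THE FAR SIDE OF S3-N2 ON `W`, UNCONDITIONAL FORM** (pair-list boundary, escaping case `j ∉ S'`, `S' ≠ ∅`, `|B_near| ≤ 1`). There is a nodup
list `hs` of non-zero COLLISION HEIGHTS such that: `hs = [] →` the escaping global centre is snc with the transformed boundary (p714892), and
`hs ≠ [] →` the repair centre `C_W = 𝓘(closure φⱼ V(C(hs)))` is admissible for `M′` and, after ANY blowing up of `W` along it, `St(Zc)` is admissible. -/
theorem farSide_globalCentre_pairs [IsAlgClosed K] (hj : j ∈ S) (hjS' : j ∉ S') (hbj : b j = 0) (hF : F ≠ 0)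
    (hclean : HauserPerlega.IsClean p F) (h0j : Θⱼ (X 0) = X 0 + rename Fin.succ h) (hsj : ∀ i : Fin 4, Θⱼ (X i.succ) = X i.succ + C (b i))
    (hπ : IsBlowup π (AffineCoordBlowup.𝓘Λ 4 K (insert 0 (Fin.succ '' (S : Set (Fin 4))))))
    (hperm : (p : ℕ∞) ≤ CentreBlowup.ordAlong S F)
    (hread : Θⱼ (coordBlowupSubst K (insert 0 (Fin.succ '' (S : Set (Fin 4)))) j.succ (hyp p F)) = X j.succ ^ p * hyp p F₁)
    (hperm' : (p : ℕ∞) ≤ CentreBlowup.ordAlong S' F₁) (L : List (Fin 4 × K))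
    (hB1 : (j, (0 : K)) ∈ L → ∀ mc ∈ L, mc.1 ∈ S → mc.1 ∈ S' → mc.2 = 0 → b mc.1 = 0)
    (hB2 : ∀ mc ∈ L, ∀ mc' ∈ L, mc.1 ∈ S → mc'.1 ∈ S → mc.1 ∈ S' → mc'.1 ∈ S' → mc.2 = 0 → mc'.2 = 0 → b mc.1 ≠ 0 → b mc'.1 ≠ 0 →
      mc.1 = mc'.1)
    {k₀ : Fin 4} (hk₀ : k₀ ∈ S') :
    haveI : IsIso (CommRingCat.ofHom (Θⱼ : A 4 K →+* A 4 K)) := (inferInstance : IsIso Θⱼ.toRingEquiv.toCommRingCatIso.hom)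
    let φⱼ := Spec.map (CommRingCat.ofHom (Θⱼ : A 4 K →+* A 4 K)) ≫ AffineCoordBlowup.chartImm hπ (succ_mem_centreVars hj)
    let Zc := vanishingIdeal (closureImage φⱼ ((AffineCoordBlowup.𝓘Λ 4 K (insert 0 (Fin.succ '' (S' : Set (Fin 4))))).support : Set (P 4 K)))
    let M' := ((⟨hypSheaf p F, L.map fun ic => ofIdealTop (Ideal.span {(γ 4 K).symm (X ic.1.succ + C ic.2)}), p⟩ :
        MarkedIdeal (P 4 K)).transform π (AffineCoordBlowup.𝓘Λ 4 K (insert 0 (Fin.succ '' (S : Set (Fin 4))))))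
    ∃ hs : List K, hs.Nodup ∧ (∀ h' ∈ hs, h' ≠ 0) ∧ (hs = [] → HasSNCWith M'.boundary Zc) ∧
      (hs ≠ [] →
        let Cmod := (hs.map fun h' => (AffineCoordBlowup.𝓘Λ 4 K (insert 0 (Fin.succ '' ((insert j S' : Finset (Fin 4)) : Set (Fin 4))))).comap
          (Spec.map (CommRingCat.ofHom ((AffinePointBlowup.translateEquiv (n := 4) (Pi.single j.succ (-h')) : A 4 K ≃ₐ[K] A 4 K) :
            A 4 K →+* A 4 K)))).prod
        let CW := vanishingIdeal (closureImage φⱼ (Cmod.support : Set (P 4 K)))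
        (CW.comap φⱼ = Cmod ∧ (CW.support : Set W) ⊆ Set.range φⱼ ∧ (CW.support : Set W) ⊆ Zc.support ∧
            (CW.support : Set W) ⊆ M'.support ∧ Scheme.IsRegular CW.subscheme ∧ HasSNCWith M'.boundary CW) ∧
          ∀ ⦃W'' : Scheme.{0}⦄ ⦃τ : W'' ⟶ W⦄, IsBlowup τ CW →
            Scheme.IsRegular (strictTransformIdeal τ CW Zc).subscheme ∧
              ((strictTransformIdeal τ CW Zc).support : Set W'') ⊆ (M'.transform τ CW).support ∧
              HasSNCWith (M'.transform τ CW).boundary (strictTransformIdeal τ CW Zc)) := by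
  intro φⱼ Zc M'
  classical
  -- the active far pairs, their heights, the index-`j` far heights, and the COLLISION heights
  let act : Finset (Fin 4 × K) := L.toFinset.filter fun ic => ic.1 ∈ S ∧ ic.1 ≠ j ∧ ic.2 ≠ 0 ∧ ic.1 ∈ S' ∧ b ic.1 ≠ 0
  let ht : Fin 4 × K → K := fun ic => -ic.2 / b ic.1
  let jf : Finset K := (L.toFinset.filter fun ic => ic.1 = j ∧ ic.2 ≠ 0).image fun ic => -ic.2
  let coll : Finset K := (act.image ht).filter fun h' =>
    (∃ ic ∈ act, ∃ kd ∈ act, ic ≠ kd ∧ ht ic = h' ∧ ht kd = h') ∨ (h' ∈ jf ∧ ∃ ic ∈ act, ht ic = h')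
  have hact : ∀ ic, ic ∈ act ↔ ic ∈ L ∧ ic.1 ∈ S ∧ ic.1 ≠ j ∧ ic.2 ≠ 0 ∧ ic.1 ∈ S' ∧ b ic.1 ≠ 0 := fun ic => by
    simp only [act, Finset.mem_filter, List.mem_toFinset]
  have hroot : ∀ ic : Fin 4 × K, b ic.1 ≠ 0 → ic.2 + b ic.1 * ht ic = 0 := fun ic hb => by
    simp only [ht]
    field_simp
    ring
  have h0 : ∀ h' ∈ coll.toList, h' ≠ 0 := by
    intro h' hh'
    rw [Finset.mem_toList] at hh'
    obtain ⟨hh'img, -⟩ := Finset.mem_filter.mp hh'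
    obtain ⟨ic, hic, rfl⟩ := Finset.mem_image.mp hh'img
    obtain ⟨-, -, -, hc, -, hb⟩ := (hact ic).mp hic
    exact div_ne_zero (neg_ne_zero.mpr hc) hb
  -- off the collision heights the height hypotheses of p714892 hold
  have hH1 : ∀ ic ∈ L, ic.1 ∈ S → ic.2 ≠ 0 → ic.1 ∈ S' → b ic.1 ≠ 0 → ∀ c : K, (j, c) ∈ L → c ≠ 0 → (∀ h' ∈ coll.toList, c + h' ≠ 0) →
      (∀ h' ∈ coll.toList, ic.2 + b ic.1 * h' ≠ 0) → ic.2 ≠ b ic.1 * c := by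
    intro ic hic hiS hc hiS' hb c hjc hc0 hch _ heq
    have hij : ic.1 ≠ j := fun e => hjS' (e ▸ hiS')
    have hica : ic ∈ act := (hact ic).mpr ⟨hic, hiS, hij, hc, hiS', hb⟩
    have hh : ht ic = -c := by
      simp only [ht]
      rw [heq, neg_div, mul_div_cancel_left₀ _ hb]
    have hmem : -c ∈ coll :=
      Finset.mem_filter.mpr ⟨Finset.mem_image.mpr ⟨ic, hica, hh⟩, Or.inr ⟨Finset.mem_image.mpr ⟨(j, c),
        Finset.mem_filter.mpr ⟨List.mem_toFinset.mpr hjc, rfl, hc0⟩, rfl⟩, ic, hica, hh⟩⟩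
    exact hch (-c) (Finset.mem_toList.mpr hmem) (add_neg_cancel c)
  have hH2 : ∀ ic ∈ L, ∀ kd ∈ L, ic ≠ kd → ic.1 ∈ S → kd.1 ∈ S → ic.2 ≠ 0 → kd.2 ≠ 0 → ic.1 ∈ S' → kd.1 ∈ S' → b ic.1 ≠ 0 → b kd.1 ≠ 0 →
      (∀ h' ∈ coll.toList, ic.2 + b ic.1 * h' ≠ 0) → (∀ h' ∈ coll.toList, kd.2 + b kd.1 * h' ≠ 0) → ic.2 * b kd.1 ≠ kd.2 * b ic.1 := by
    intro ic hic kd hkd hne hiS hkS hc hd hiS' hkS' hb hb' hich _ heq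
    have hij : ic.1 ≠ j := fun e => hjS' (e ▸ hiS')
    have hkj : kd.1 ≠ j := fun e => hjS' (e ▸ hkS')
    have hica : ic ∈ act := (hact ic).mpr ⟨hic, hiS, hij, hc, hiS', hb⟩
    have hkda : kd ∈ act := (hact kd).mpr ⟨hkd, hkS, hkj, hd, hkS', hb'⟩
    have hh : ht ic = ht kd := by
      simp only [ht]
      rw [div_eq_div_iff hb hb', neg_mul, neg_mul, heq]
    have hmem : ht ic ∈ coll :=
      Finset.mem_filter.mpr ⟨Finset.mem_image.mpr ⟨ic, hica, rfl⟩, Or.inl ⟨ic, hica, kd, hkda, hne, rfl, hh.symm⟩⟩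
    exact hich (ht ic) (Finset.mem_toList.mpr hmem) (hroot ic hb)
  refine ⟨coll.toList, Finset.nodup_toList _, h0, fun hnil => ?_, fun hne => ⟨?_, ?_⟩⟩
  · -- no collision: p714892
    exact hasSNCWith_transform_boundary_globalCentre_of_far_heights_pairs hj hjS' hbj hF hclean h0j hsj hπ hperm hread hperm' L hB1 hB2
      (fun ic hic hiS hc hiS' hb c hjc hc0 => hH1 ic hic hiS hc hiS' hb c hjc hc0 (fun h' hh' => by rw [hnil] at hh'; simp at hh')
        fun h' hh' => by rw [hnil] at hh'; simp at hh')
      fun ic hic kd hkd hne' hiS hkS hc hd hiS' hkS' hb hb' => hH2 ic hic kd hkd hne' hiS hkS hc hd hiS' hkS' hb hb'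
        (fun h' hh' => by rw [hnil] at hh'; simp at hh') fun h' hh' => by rw [hnil] at hh'; simp at hh'
  · -- the repair centre is admissible
    exact farRepairCentre_package_pairs hj hjS' hbj h0j hsj hπ hperm hread hperm' L coll.toList hne (Finset.nodup_toList _) h0
  · -- after the repair
    exact admissible_strictTransform_after_farRepairW_pairs hj hjS' hbj hF hclean h0j hsj hπ hperm hread hperm' L hB1 hB2 coll.toList hne
      (Finset.nodup_toList _) h0 hH1 hH2 hk₀

end ChartDictionary

end Summit.ResolutionOfSingularities.ResolutionOfSingularities.Theorems.PIDim4

end
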